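import Summits.QuantumFields.YangMills.Theorems.BalabanUVNodesN15KingModelFullPropagatorBgLetters
import Summits.QuantumFields.YangMills.Theorems.BalabanUVNodesN15KingModelFullPropagatorNE2Operator

/-!
# BalabanUVNodes ∕ N15 — THE KING-MODEL RUNG, PART Σ-b: THE JOINT -e∕-b KNIT — `T4EtaRate.NE2PlusOperator` BY NAME FOR KING's FULL `A = 0` PROPAGATOR
# DRESSED BY THE ZEROTH-ORDER BACKGROUND SPECIES — background block LIVE ((3.35) consumed), size guard LIVE, every `U ≡ 1` input a landed theorem of the rung
# (Track A, DAG node N15 = NE2; FAN-OUT v1.1 §N15 s3 «KING-MODEL ∕ RIEMANN-KERNEL RUNG»; the joint -e∕-b knit, knit half)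

HONEST FRAMING.  Count-neutral KNIT (cell `pub-ymgap`, seat `pub-ymgap-dag-n15-e` g11; `--supports stmt-QuantumFields-20544 --as helper` = K3⁷
`SpineGivenEndpointR13SepCoPH`).  No new estimate.  n15-b's A4 `BackgroundLayer.ne2PlusOperator_background4` proves `NE2PlusOperator` BY NAME, the background
block LIVE, for ANY family of data whose only displayed hypotheses are the nine `U ≡ 1` letters (five plain block majorants, four η-defects); dag-n15-a's part 27
`…N15VectorPieceBackground` fired it on the single-scale vector piece `H_k·C^{(k)}·η^{d+1}H_kᵀ`.  THIS FILE fires it on the rung's FULL multi-level propagator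
`A₀⁻¹ = (fineOp (L^K) M a_K (L^K)² m²)⁻¹` — King's `A = 0` fluctuation propagator `G_K(T_ε, 0)` ([King1986] (2.13), [Ba 4] (1.6) at `A = 0`) with ALL `K` levels
summed — every letter being part Σ-a's `kingFullProp_uniform_layer` (parts Ψ-e ∕ P″ ∕ Q4a ∕ Q4b by name).  Data of the realised family, index `i : KingBgIdx d m₀²`
(cube `2L^e`, `K ≥ 1` coarse levels, scale shift `n ≥ 1`, mass `0 < m² ≤ m₀²`, size datum `M ≥ 1`, direction `μ`): carrier `unitTorusGeoS L K (2L^e) M` (so the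
fine instance's [B9] size parameter IS the datum `M` — `bgKingInstance_gf_M`; the guard `M₅ ≤ M`, the smallness `M·α₀ ≤ a₀` and the (3.35) letters
`|c′| ≤ c₃₅·M·α₀`, `FibreOsc π c′ (c₃₅·M·α₀·θ)` are LIVE), blocks `blockOf`, King's pairing `underPtN`, scale shift `n`, rate number `θ_i = (L^K)^{−γ∕2}`,
background carriers = n15-b's coefficient fields `coeffBg` with `Reg335` = the (3.35) letter pair, transport = block average.
* §1 `KingBgIdx` (+ `_nonempty`), `thetaK`, `bgKingInstance`, `bgKingFamily`, `bgKingInstance_gf_M` ∕ `_gc_k` (`rfl`: guard = the datum), `exists_kingBgIdx_size_levels_ge` (size AND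
  level count cofinal — not the statement-level-vacuity trap of ref-B READ-335), `reg335_bgKing_iff`.
* §2 ★★ **`ne2PlusOperator_kingFullProp_background`**: for `d ≥ 0`, odd `L ≥ 3`, `a > 0`, `m₀² > 0`, `0 < γ < 1` and every `c₃₅ > 0`,
  `NE2PlusOperator c₃₅ (bgKingInstance L a γ) (bgKingFamily L a γ)` — A4 instantiated (`M₅ = 1`, `a₀ = (2c₃₅(βc_r + 1))⁻¹`, `B₀ = bgConst + bgConst1 + 1`,
  `δ₀ = δ∕2`, exponent `γ∕2`); `_dim4` (`d + 1 = 4`).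
WHAT IT SAYS.  For King's full propagator DRESSED by a scalar background `c′` — `X′(c′) = (1 − A₀′⁻¹M_{c′})⁻¹A₀′⁻¹ = (A₀′ − M_{c′})⁻¹` on the fine run against
`X(c̄) = (A₀ − M_{c̄})⁻¹` on the coarse run, `c̄` the block average — the four (3.42) entry η-defects obey `EtaRateIneq342` with ONE `(B₀, δ₀, γ∕2)` at every index
and every `c′` in the (3.35) window: NE2⁺'s operator layer with the «+» block live, in King's model, for a potential-type perturbation.
WHAT THE CURVED CASE STILL ADDS (one line): Bałaban's `G(U)` — the FIRST-ORDER (covariant-Laplacian) species `V′(A)` of (3.52) with matrix coefficients and the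
by-parts entry 2 (n15-b B-series, n15-c M-files ∕ `…Entry2ByParts`), over the multiscale carrier with `(L^jη)`-prefactors — NOT touched here; NE2⁺ is NOT PRINTED
and not proved; NOT a node discharge; count-neutral; nothing continuum ∕ ℝ⁴ ∕ OS ∕ mass-gap ∕ Clay.  0 `sorry`, standard axioms; plumbing `def`s only (§1).
Locators: [Balaban1985BackgroundPropagators] Thm 3.1 (3.42) p. 397 (quantifier template), (3.35) p. 396, (3.63)–(3.65) pp. 402–403 (mechanism), Thm 3.14 pp. 426–427
(typing template); [King1986] (2.13)–(2.17) p. 653, p. 664 (pairing), Prop. 3.8 (3.71) p. 664, Prop. 3.9 (3.73) p. 665; [Balaban1983RegularityDecay] (1.6) p. 572.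
-/

noncomputable section

namespace Summit.QuantumFields.YangMills.BalabanUVNodes.N15KingModelRung.Curved

open Real Finset Matrix
open Literature.MathematicalPhysics.QuantumFieldTheory.Balaban1983to89
open Literature.MathematicalPhysics.QuantumFieldTheory.Balaban1983to89.B11SectG (BlockNorm HasMaj RowSum)
open Literature.MathematicalPhysics.QuantumFieldTheory.Balaban1983to89.T4EtaRate (PairedInstance NE2PlusOperator)
open Literature.MathematicalPhysics.QuantumFieldTheory.Balaban1983to89.T4EtaRateDefect (idef rateWeight)
open Literature.MathematicalPhysics.QuantumFieldTheory.Balaban1983to89.T4EtaRateCoeffDefect (pull FibreOsc)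
open Literature.MathematicalPhysics.QuantumFieldTheory.Balaban1983to89.B5Prop11Plancherel (Tor fine)
open Literature.MathematicalPhysics.QuantumFieldTheory.Balaban1983to89.B6UnitTorusCarrier (unitTorusGeo unitTorusGeo_len triangle254_unitTorusGeo
  rowSum_unitTorusGeo)
open Literature.MathematicalPhysics.QuantumFieldTheory.King1986.Torus (blockOf tdistT tdistT_nonneg)
open Summit.QuantumFields.YangMills.BalabanUVNodes.N15.BackgroundLayer (coeffBg bgInstance bgFamily4 ne2PlusOperator_background4)
open Summit.QuantumFields.YangMills.BalabanUVNodes.N15.VectorPiece (unitTorusGeoS unitTorusGeoS_M rateWeight_unitTorusGeoS)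

variable {d : ℕ} (L : ℕ) [NeZero L]

/-! ## §1 The index, the rate number, the realised background instance family of King's full propagator -/

section Data

/-- Index of the realised family: part Q5's `EtaLatIdx` (cube `2L^e`, coarse run `K ≥ 1`, scale shift `n ≥ 1`, mass `0 < m² ≤ m₀²`, size datum `M ≥ 1`) and a
lattice direction `μ` (entries 1–2 of (3.42) are read one direction at a time). [folklore] -/
structure KingBgIdx (d : ℕ) (m0sq : ℝ) extends EtaLatIdx d m0sq where
  /-- the direction of the difference ∕ source entries -/
  μ : Fin (d + 1)

omit [NeZero L] in
/-- The index type is inhabited as soon as the mass window is (`0 < m₀²`; not the empty-index trap). [folklore] -/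
theorem kingBgIdx_nonempty (d : ℕ) {m0sq : ℝ} (hm0 : 0 < m0sq) : Nonempty (KingBgIdx d m0sq) :=
  let ⟨i⟩ := etaLatIdx_nonempty d hm0
  ⟨⟨i, 0⟩⟩

variable {m0sq : ℝ}

/-- THE RATE NUMBER of an index: `θ_i = (L^K)^{−γ∕2}` (King's `L^{−γ∕2}` per level, `K` levels). [cite: King1986, Prop. 3.9 (3.73) p.665 (rate factor)] -/
def thetaK (γ : ℝ) (i : KingBgIdx d m0sq) : ℝ := ((L : ℝ) ^ i.K) ^ (-(γ / 2))

/-- `L ≠ 0` as a real number, for the sized carrier's `L` field. [folklore] -/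
theorem unitTorusGeoS_L_ne_zero' (i : KingBgIdx d m0sq) : (unitTorusGeoS L i.K (EtaLatIdx.cube L i.toEtaLatIdx) i.Msz).L ≠ 0 :=
  Nat.cast_ne_zero.mpr (NeZero.ne L)

/-- THE REALISED BACKGROUND INSTANCE at an index: n15-b's `bgInstance` over the SIZED unit-torus carrier of the cube `2L^e` with `K` levels, blocks `blockOf`,
King's pairing `underPtN` to the run with `K + n` levels, scale shift `n`, rate number `θ_i` (coarse and fine coefficient carriers = the (3.35) letter pair with the
index's `M`). [cite: Balaban1985BackgroundPropagators, Thm 3.14 pp.426–427 (typing template); (3.35) p.396; King1986, p.664 (pairing)] -/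
def bgKingInstance (γ : ℝ) (i : KingBgIdx d m0sq) : PairedInstance :=
  bgInstance (g := unitTorusGeoS L i.K (EtaLatIdx.cube L i.toEtaLatIdx) i.Msz) (blockOf (L ^ i.K) (EtaLatIdx.cube L i.toEtaLatIdx))
    (underPtN L i.K i.n (EtaLatIdx.cube L i.toEtaLatIdx)) i.n (unitTorusGeoS_L_ne_zero' L i) (thetaK L γ i) (thetaK L γ i)

/-- THE REALISED KERNEL FAMILY: n15-b's `bgFamily4` (all four (3.42) entries of the background-dependent pair CONSTRUCTED by the fixed-point equation (3.65), A1∕A3)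
fed with the rung's operators — `G = A₀⁻¹`, `D_μ = N∇_μA₀⁻¹`, `S_μ = A₀⁻¹N∇*_μ`, `N²ΔA₀⁻¹` of the coarse run and their fine-run twins (part Σ-a `kingGOp` ∕ `kingDOp` ∕
`kingSOp` ∕ `kingLapOp`). [cite: Balaban1985BackgroundPropagators, (3.42) p.397, (3.63)–(3.65) pp.402–403 (shapes, mechanism); King1986, (2.13) p.653] -/
def bgKingFamily (a γ : ℝ) (i : KingBgIdx d m0sq) : B9.KernelFamily (bgKingInstance (d := d) L γ i).gc (bgKingInstance (d := d) L γ i).Bf :=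
  bgFamily4 (g := unitTorusGeoS L i.K (EtaLatIdx.cube L i.toEtaLatIdx) i.Msz) (blockOf (L ^ i.K) (EtaLatIdx.cube L i.toEtaLatIdx))
    (underPtN L i.K i.n (EtaLatIdx.cube L i.toEtaLatIdx)) i.n (unitTorusGeoS_L_ne_zero' L i) (thetaK L γ i) (thetaK L γ i)
    (kingGOp L a i.msq i.K (L ^ i.K) (EtaLatIdx.cube L i.toEtaLatIdx)) (kingDOp L a i.msq i.K (L ^ i.K) (EtaLatIdx.cube L i.toEtaLatIdx) i.μ)
    (kingSOp L a i.msq i.K (L ^ i.K) (EtaLatIdx.cube L i.toEtaLatIdx) i.μ) (kingLapOp L a i.msq i.K (L ^ i.K) (EtaLatIdx.cube L i.toEtaLatIdx))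
    (kingGOp L a i.msq (i.K + i.n) (L ^ i.n * L ^ i.K) (EtaLatIdx.cube L i.toEtaLatIdx))
    (kingDOp L a i.msq (i.K + i.n) (L ^ i.n * L ^ i.K) (EtaLatIdx.cube L i.toEtaLatIdx) i.μ)
    (kingSOp L a i.msq (i.K + i.n) (L ^ i.n * L ^ i.K) (EtaLatIdx.cube L i.toEtaLatIdx) i.μ)
    (kingLapOp L a i.msq (i.K + i.n) (L ^ i.n * L ^ i.K) (EtaLatIdx.cube L i.toEtaLatIdx))

/-- **THE GUARD IS LIVE**: the fine realised instance's [B9] size parameter IS the index's `M` (n15-b's `bgInstance_M` on the sized carrier) — and the index family has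
unbounded `M`. [folklore] -/
theorem bgKingInstance_gf_M (γ : ℝ) (i : KingBgIdx d m0sq) : (bgKingInstance (d := d) L γ i).gf.M = i.Msz := rfl

/-- The coarse realised instance's number of levels IS the index's `K`. [folklore] -/
theorem bgKingInstance_gc_k (γ : ℝ) (i : KingBgIdx d m0sq) : (bgKingInstance (d := d) L γ i).gc.k = i.K := rfl

/-- **NOT THE STATEMENT-LEVEL-VACUITY TRAP** (ref-B READ-335's probe; dag-n15-w2's liveness guard): the size parameter `M` of the fine instances AND the number of levels of the
coarse instances are COFINAL over the family — for every `R` and `k` some index has `gf.M ≥ R` and `gc.k ≥ k` — so neither the guard `M₅ ≤ M` nor a bound on the level count can void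
the «+» block. [folklore] -/
theorem exists_kingBgIdx_size_levels_ge (hm0 : 0 < m0sq) (γ R : ℝ) (k : ℕ) :
    ∃ i : KingBgIdx d m0sq, R ≤ (bgKingInstance (d := d) L γ i).gf.M ∧ k ≤ (bgKingInstance (d := d) L γ i).gc.k :=
  ⟨⟨⟨0, max k 1, le_max_right _ _, 1, le_rfl, m0sq, hm0, le_rfl, max R 1, le_max_right _ _⟩, 0⟩, le_max_left _ _, le_max_left _ _⟩

/-- WHAT (3.35) SAYS HERE: a fine coefficient field `c′` on the run with `K + n` levels is `Reg335 c₃₅ α₀`-regular iff `|c′| ≤ c₃₅·M·α₀` pointwise and its oscillation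
over every King fibre `π⁻¹(x)` is `≤ c₃₅·M·α₀·θ_i` — the printed letter pair «|A| < O(1)Mα₀(L^jη)^{−1}, |∇^ηA| < O(1)Mα₀(L^jη)^{−2} on □» read blockwise, with the
index's OWN `M`. [cite: Balaban1985BackgroundPropagators, (3.35) p.396] -/
theorem reg335_bgKing_iff (γ : ℝ) (i : KingBgIdx d m0sq) (c35 α₀ : ℝ) (c' : Tor (fine (L ^ i.n * L ^ i.K) (EtaLatIdx.cube L i.toEtaLatIdx)) → ℝ) :
    (bgKingInstance (d := d) L γ i).Bf.Reg335 c35 α₀ c' ↔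
      (∀ x', |c' x'| ≤ c35 * i.Msz * α₀) ∧ FibreOsc (underPtN L i.K i.n (EtaLatIdx.cube L i.toEtaLatIdx)) c' (fun _ => c35 * i.Msz * α₀ * thetaK L γ i) :=
  Iff.rfl

end Data

/-! ## §2 THE KNIT: `NE2PlusOperator` BY NAME for King's full propagator, background block live, size guard live, every `U ≡ 1` input a tree theorem -/

section Knit

/-- ★★ **NE2⁺, OPERATOR LAYER — THE NODE's FIRST CONJUNCT `T4EtaRate.NE2PlusOperator` BY NAME FOR KING's FULL `A = 0` PROPAGATOR DRESSED BY THE ZEROTH-ORDER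
BACKGROUND SPECIES**, on the realised family indexed by `KingBgIdx d m₀²`: (3.35) CONSUMED (the coefficient carrier's `Reg335` supplies the sup and oscillation letters,
the guard `M·α₀ ≤ a₀` the contraction), the size guard `M₅ ≤ M` LIVE (`bgKingInstance_gf_M`, unbounded `M`), all four (3.42) entries of the background-dependent pair
`(X′(c′), X(c̄)) = ((A₀′ − M_{c′})⁻¹, (A₀ − M_{c̄})⁻¹)` CONSTRUCTED (n15-b A1∕A3), and EVERY `U ≡ 1` input a landed theorem of the rung (part Σ-a `kingFullProp_uniform_layer`:
Ψ-e ∕ P″ ∕ Q4a ∕ Q4b) — for the FULL multi-level propagator, uniformly in `K`, `n`, the volume and the mass.  n15-b's A4 `ne2PlusOperator_background4` instantiated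
(`σ = δ∕2`, exponent `γ∕2`). [cite: Balaban1985BackgroundPropagators, Thm 3.1 p.397 (quantifier template), (3.35) p.396, (3.42) p.397, (3.63)–(3.65) pp.402–403 (shapes, mechanism); King1986, (2.13)–(2.17) p.653, Prop. 3.8 (3.71) p.664, Prop. 3.9 (3.73) p.665 (A = 0 model, rate factor)] -/
theorem ne2PlusOperator_kingFullProp_background (hLodd : Odd L) (hL : 2 ≤ L) {a : ℝ} (ha : 0 < a) {m0sq : ℝ} (hm0 : 0 ≤ m0sq) {γ : ℝ} (hγ0 : 0 < γ)
    (hγ1 : γ < 1) (c35 : ℝ) (hc35 : 0 < c35) :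
    NE2PlusOperator c35 (bgKingInstance (d := d) (m0sq := m0sq) L γ) (bgKingFamily (d := d) (m0sq := m0sq) L a γ) := by
  obtain ⟨β, δ, m₀, hβ, hδ, hm₀, H⟩ := kingFullProp_uniform_layer (d := d) L hLodd hL ha hm0 hγ0.le hγ1
  have hL0 : L ≠ 0 := NeZero.ne L
  have hLr : (0 : ℝ) < (L : ℝ) := by exact_mod_cast Nat.pos_of_ne_zero hL0
  have hσ : 0 < δ / 2 := half_pos hδ
  have hcube : ∀ i : KingBgIdx d m0sq, ∀ μ, EtaLatIdx.cube L i.toEtaLatIdx μ = 2 * L ^ i.e := fun i μ => rfl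
  exact ne2PlusOperator_background4 (I := KingBgIdx d m0sq) (fun i => unitTorusGeoS L i.K (EtaLatIdx.cube L i.toEtaLatIdx) i.Msz)
    (fun i => Tor (fine (L ^ i.K) (EtaLatIdx.cube L i.toEtaLatIdx))) (fun i => Tor (fine (L ^ i.n * L ^ i.K) (EtaLatIdx.cube L i.toEtaLatIdx)))
    (fun i => blockOf (L ^ i.K) (EtaLatIdx.cube L i.toEtaLatIdx)) (fun i => underPtN L i.K i.n (EtaLatIdx.cube L i.toEtaLatIdx)) (fun i => i.n)
    (fun i => unitTorusGeoS_L_ne_zero' L i) (thetaK L γ) (thetaK L γ)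
    (fun i => kingGOp L a i.msq i.K (L ^ i.K) (EtaLatIdx.cube L i.toEtaLatIdx)) (fun i => kingDOp L a i.msq i.K (L ^ i.K) (EtaLatIdx.cube L i.toEtaLatIdx) i.μ)
    (fun i => kingSOp L a i.msq i.K (L ^ i.K) (EtaLatIdx.cube L i.toEtaLatIdx) i.μ) (fun i => kingLapOp L a i.msq i.K (L ^ i.K) (EtaLatIdx.cube L i.toEtaLatIdx))
    (fun i => kingGOp L a i.msq (i.K + i.n) (L ^ i.n * L ^ i.K) (EtaLatIdx.cube L i.toEtaLatIdx))
    (fun i => kingDOp L a i.msq (i.K + i.n) (L ^ i.n * L ^ i.K) (EtaLatIdx.cube L i.toEtaLatIdx) i.μ)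
    (fun i => kingSOp L a i.msq (i.K + i.n) (L ^ i.n * L ^ i.K) (EtaLatIdx.cube L i.toEtaLatIdx) i.μ)
    (fun i => kingLapOp L a i.msq (i.K + i.n) (L ^ i.n * L ^ i.K) (EtaLatIdx.cube L i.toEtaLatIdx))
    c35 hc35 (fun i => triangle254_unitTorusGeo L i.K _) (fun i a b => tdistT_nonneg _ _ _) hσ.le (B4Sect5Proof.latticeConst_nonneg (d + 1) hσ.le)
    (fun i => rowSum_unitTorusGeo L i.K _ hσ) (fun i => inv_pos.mpr (pow_pos hLr _)) (fun i => hLr) (fun i y => (unitTorusGeo_len L i.K _ hL0 y).symm.le)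
    (by linarith) hβ.le hm₀.le (half_pos hγ0) (fun i => Real.rpow_nonneg (pow_nonneg hLr.le _) _) (fun i y => le_rfl)
    (fun i => (H i.K i.one_le_K i.n i.one_le_n i.e _ (hcube i) i.msq i.msq_pos i.msq_le i.Msz i.μ).1)
    (fun i => (H i.K i.one_le_K i.n i.one_le_n i.e _ (hcube i) i.msq i.msq_pos i.msq_le i.Msz i.μ).2.1)
    (fun i => (H i.K i.one_le_K i.n i.one_le_n i.e _ (hcube i) i.msq i.msq_pos i.msq_le i.Msz i.μ).2.2.1)
    (fun i => (H i.K i.one_le_K i.n i.one_le_n i.e _ (hcube i) i.msq i.msq_pos i.msq_le i.Msz i.μ).2.2.2.1)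
    (fun i => (H i.K i.one_le_K i.n i.one_le_n i.e _ (hcube i) i.msq i.msq_pos i.msq_le i.Msz i.μ).2.2.2.2.1)
    (fun i => (H i.K i.one_le_K i.n i.one_le_n i.e _ (hcube i) i.msq i.msq_pos i.msq_le i.Msz i.μ).2.2.2.2.2.1)
    (fun i => (H i.K i.one_le_K i.n i.one_le_n i.e _ (hcube i) i.msq i.msq_pos i.msq_le i.Msz i.μ).2.2.2.2.2.2.1)
    (fun i => (H i.K i.one_le_K i.n i.one_le_n i.e _ (hcube i) i.msq i.msq_pos i.msq_le i.Msz i.μ).2.2.2.2.2.2.2.1)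
    (fun i => (H i.K i.one_le_K i.n i.one_le_n i.e _ (hcube i) i.msq i.msq_pos i.msq_le i.Msz i.μ).2.2.2.2.2.2.2.2)

/-- The four-dimensional instance (`d + 1 = 4`). [cite: Balaban1985BackgroundPropagators, Thm 3.1 p.397 (quantifier template)] -/
theorem ne2PlusOperator_kingFullProp_background_dim4 (hLodd : Odd L) (hL : 2 ≤ L) {a : ℝ} (ha : 0 < a) {m0sq : ℝ} (hm0 : 0 ≤ m0sq) {γ : ℝ} (hγ0 : 0 < γ)
    (hγ1 : γ < 1) (c35 : ℝ) (hc35 : 0 < c35) :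
    NE2PlusOperator c35 (bgKingInstance (d := 3) (m0sq := m0sq) L γ) (bgKingFamily (d := 3) (m0sq := m0sq) L a γ) :=
  ne2PlusOperator_kingFullProp_background (d := 3) L hLodd hL ha hm0 hγ0 hγ1 c35 hc35

end Knit

end Summit.QuantumFields.YangMills.BalabanUVNodes.N15KingModelRung.Curved

end
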